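import Literature.Analysis.FluidPDE.BallisticFreeEnergy
import HarnessLib

/-!
# One-dimensional estimates for the ballistic free energy

Quantitative versions, at a fixed reference state `(r, Θ)`, of the structural properties of
`H_Θ(ρ,ϑ) = ρ e - Θ ρ s` proved in `BallisticFreeEnergy.lean` (Feireisl–Novotný 2009, Ch. 3,
Prop. 3.2; Březina–Feireisl 2018, (3.8)). All statements are along a single isotherm `ϑ = Θ`
(variable `ρ`) or a single isochore `ρ = const` (variable `ϑ`), with the needed lower bounds on
`∂_ρ p/ρ` resp. `∂_ϑ s` over an interval taken as HYPOTHESES; the uniform-in-`K` coercivity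
statement that feeds the weak–strong uniqueness argument (where these bounds come from
compactness) is assembled in `BallisticFreeEnergyCoercivity.lean`.

* `chemPotential_sub_ge` — `m (τ - σ) ≤ μ(τ,Θ) - μ(σ,Θ)` if `∂_ρ p/ρ ≥ m` on `[σ, τ]`;
* `relEnergyThermo_diag_ge_sq` — `(m/2)(ρ - r)² ≤ R(ρ,Θ)` on `|ρ - r| ≤ δ`;
* `monotoneOn_relEnergyThermo_diag` / `antitoneOn_relEnergyThermo_diag` — `ρ ↦ R(ρ,Θ)` decreases
  on `(0, r]` and increases on `[r, ∞)`;
* `relEnergyThermo_diag_ge_linear` — linear growth `R(ρ,Θ) ≥ (μ(r+δ,Θ) - μ(r,Θ))(ρ - r - δ)`;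
* `ballisticFreeEnergy_sub_ge_sq` — `(m ρ/2)(ϑ - Θ)² ≤ H_Θ(ρ,ϑ) - H_Θ(ρ,Θ)` on `|ϑ - Θ| ≤ δ`;
* `e_le_e_of_le` — `e` is non-decreasing in `ϑ`;
* `energy_sub_le_two_mul_ballisticFreeEnergy_sub` — `ρe(ρ,ϑ) - ρe(ρ,2Θ) ≤ 2(H_Θ(ρ,ϑ) - H_Θ(ρ,2Θ))`
  for `ϑ ≥ 2Θ`;
* `e_mul_inv_sub_inv_le` — `e(ρ,ϑ₀)(1/ϑ₀ - 1/ϑ₁) ≤ f(ρ,ϑ₀)/ϑ₀ - f(ρ,ϑ₁)/ϑ₁` for `ϑ₀ ≤ ϑ₁`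
  (from `d/dϑ (f/ϑ) = -e/ϑ²` and monotonicity of `e`).

## References

* E. Feireisl, A. Novotný, *Singular limits in thermodynamics of viscous fluids* (2009), Ch. 3,
  Prop. 3.2 and §2.2.3.
* J. Březina, E. Feireisl, J. Math. Soc. Japan 70 (2018), (3.8).
-/

noncomputable section

open Set Filter Function
open scoped Topology

namespace Literature.Analysis.FluidPDE

namespace CompressibleEuler

namespace EulerEOS

variable {eos : EulerEOS}

/-! ## A generic monotonicity tool -/

/-- If `F` has derivative `F'` at every point of `[a, b]` and `F' ≥ 0` on `(a, b)`, then `F` is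
monotone on `[a, b]`. [folklore] -/
theorem monotoneOn_Icc_of_hasDerivAt_nonneg {F F' : ℝ → ℝ} {a b : ℝ}
    (hF : ∀ x ∈ Icc a b, HasDerivAt F (F' x) x) (hnn : ∀ x ∈ Ioo a b, 0 ≤ F' x) :
    MonotoneOn F (Icc a b) := by
  refine monotoneOn_of_deriv_nonneg (convex_Icc a b) (fun x hx => (hF x hx).continuousAt
    |>.continuousWithinAt) (fun x hx => ?_) (fun x hx => ?_)
  · rw [interior_Icc] at hx
    exact (hF x (Ioo_subset_Icc_self hx)).differentiableAt.differentiableWithinAt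
  · rw [interior_Icc] at hx
    rw [(hF x (Ioo_subset_Icc_self hx)).deriv]
    exact hnn x hx

/-- If `F` has derivative `F'` at every point of `[a, b]` and `F' ≤ 0` on `(a, b)`, then `F` is
antitone on `[a, b]`. [folklore] -/
theorem antitoneOn_Icc_of_hasDerivAt_nonpos {F F' : ℝ → ℝ} {a b : ℝ}
    (hF : ∀ x ∈ Icc a b, HasDerivAt F (F' x) x) (hnp : ∀ x ∈ Ioo a b, F' x ≤ 0) :
    AntitoneOn F (Icc a b) := by
  refine antitoneOn_of_deriv_nonpos (convex_Icc a b) (fun x hx => (hF x hx).continuousAt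
    |>.continuousWithinAt) (fun x hx => ?_) (fun x hx => ?_)
  · rw [interior_Icc] at hx
    exact (hF x (Ioo_subset_Icc_self hx)).differentiableAt.differentiableWithinAt
  · rw [interior_Icc] at hx
    rw [(hF x (Ioo_subset_Icc_self hx)).deriv]
    exact hnp x hx

/-- If `F` has derivative `F'` at every point of `[a, ∞)` and `F' ≥ 0` on `(a, ∞)`, then `F` is
monotone on `[a, ∞)`. [folklore] -/
theorem monotoneOn_Ici_of_hasDerivAt_nonneg {F F' : ℝ → ℝ} {a : ℝ}
    (hF : ∀ x ∈ Ici a, HasDerivAt F (F' x) x) (hnn : ∀ x ∈ Ioi a, 0 ≤ F' x) :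
    MonotoneOn F (Ici a) := by
  refine monotoneOn_of_deriv_nonneg (convex_Ici a) (fun x hx => (hF x hx).continuousAt
    |>.continuousWithinAt) (fun x hx => ?_) (fun x hx => ?_)
  · rw [interior_Ici] at hx
    exact (hF x (mem_Ici.2 (le_of_lt hx))).differentiableAt.differentiableWithinAt
  · rw [interior_Ici] at hx
    rw [(hF x (mem_Ici.2 (le_of_lt hx))).deriv]
    exact hnn x hx

/-! ## Along the reference isotherm `ϑ = Θ` -/

/-- **Increment of the chemical potential**: if `∂_ρ p(ξ,Θ)/ξ ≥ m` for `ξ ∈ [σ, τ] ⊂ (0,∞)`, then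
`m (τ - σ) ≤ μ(τ,Θ) - μ(σ,Θ)`. [cite: FeireislNovotny2009, Ch. 3 Prop. 3.2] -/
theorem chemPotential_sub_ge (hG : eos.IsGibbs) {Θ σ τ m : ℝ} (hΘ : 0 < Θ) (hσ : 0 < σ)
    (hστ : σ ≤ τ) (hm : ∀ ξ ∈ Icc σ τ, m ≤ deriv (fun r => eos.p r Θ) ξ / ξ) :
    m * (τ - σ) ≤ eos.chemPotential τ Θ - eos.chemPotential σ Θ := by
  have hmono : MonotoneOn (fun ξ => eos.chemPotential ξ Θ - m * ξ) (Icc σ τ) := by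
    refine monotoneOn_Icc_of_hasDerivAt_nonneg
      (F' := fun ξ => deriv (fun r => eos.p r Θ) ξ / ξ - m * 1) (fun ξ hξ => ?_) (fun ξ hξ => ?_)
    · exact (hG.hasDerivAt_chemPotential_rho (hσ.trans_le hξ.1) hΘ).fun_sub
        ((hasDerivAt_id' ξ).const_mul m)
    · have := hm ξ (Ioo_subset_Icc_self hξ)
      linarith
  have := hmono (left_mem_Icc.2 hστ) (right_mem_Icc.2 hστ) hστ
  simp only at this
  linarith

/-- **Quadratic lower bound along the isotherm**: if `∂_ρ p(ξ,Θ)/ξ ≥ m ≥ 0` for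
`ξ ∈ [r - δ, r + δ] ⊂ (0,∞)`, then `(m/2)(ρ - r)² ≤ R(ρ,Θ | r,Θ)` for `|ρ - r| ≤ δ`.
[cite: FeireislNovotny2009, Ch. 3 Prop. 3.2] -/
theorem relEnergyThermo_diag_ge_sq (hG : eos.IsGibbs) {r Θ δ m ρ : ℝ} (hΘ : 0 < Θ)
    (hrδ : 0 < r - δ) (hδ : 0 ≤ δ)
    (hm : ∀ ξ ∈ Icc (r - δ) (r + δ), m ≤ deriv (fun x => eos.p x Θ) ξ / ξ)
    (hρ : ρ ∈ Icc (r - δ) (r + δ)) :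
    m / 2 * (ρ - r) ^ 2 ≤ eos.relEnergyThermo r Θ ρ Θ := by
  -- `G(σ) := R(σ,Θ) - (m/2)(σ - r)²`, `G' = μ(σ) - μ(r) - m (σ - r)`
  set G : ℝ → ℝ := fun σ => eos.relEnergyThermo r Θ σ Θ - m / 2 * (σ - r) ^ 2 with hGdef
  have hr : 0 < r := hrδ.trans_le (by linarith)
  have hderiv : ∀ σ, 0 < σ → HasDerivAt G
      (eos.chemPotential σ Θ - eos.chemPotential r Θ - m * (σ - r)) σ := by
    intro σ hσ
    have h1 : HasDerivAt (fun σ => eos.relEnergyThermo r Θ σ Θ)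
        (eos.chemPotential σ Θ - eos.chemPotential r Θ * 1) σ := by
      unfold relEnergyThermo
      exact ((hG.hasDerivAt_ballisticFreeEnergy_rho hσ hΘ).fun_sub
        (((hasDerivAt_id' σ).sub_const r).const_mul _)).sub_const _
    have h2 : HasDerivAt (fun σ => m / 2 * (σ - r) ^ 2) (m / 2 * (2 * (σ - r) ^ 1 * 1)) σ :=
      (((hasDerivAt_id' σ).sub_const r).pow 2).const_mul _
    have h := h1.fun_sub h2
    refine h.congr_deriv ?_
    ring
  have hpos : ∀ σ ∈ Icc (r - δ) (r + δ), 0 < σ := fun σ hσ => hrδ.trans_le hσ.1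
  -- right half: monotone on `[r, r + δ]`
  have hright : MonotoneOn G (Icc r (r + δ)) := by
    refine monotoneOn_Icc_of_hasDerivAt_nonneg (fun σ hσ => hderiv σ (hr.trans_le hσ.1))
      (fun σ hσ => ?_)
    have hsub : Icc r σ ⊆ Icc (r - δ) (r + δ) := Icc_subset_Icc (by linarith) hσ.2.le
    have := chemPotential_sub_ge hG hΘ hr hσ.1.le (fun ξ hξ => hm ξ (hsub hξ))
    linarith
  -- left half: antitone on `[r - δ, r]`
  have hleft : AntitoneOn G (Icc (r - δ) r) := by
    refine antitoneOn_Icc_of_hasDerivAt_nonpos (fun σ hσ => hderiv σ (hrδ.trans_le hσ.1))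
      (fun σ hσ => ?_)
    have hsub : Icc σ r ⊆ Icc (r - δ) (r + δ) := Icc_subset_Icc hσ.1.le (by linarith)
    have := chemPotential_sub_ge hG hΘ (hrδ.trans hσ.1) hσ.2.le (fun ξ hξ => hm ξ (hsub hξ))
    linarith
  have hGr : G r = 0 := by simp [hGdef]
  have key : G r ≤ G ρ := by
    rcases le_total r ρ with h | h
    · exact hright ⟨le_refl r, by linarith⟩ ⟨h, hρ.2⟩ h
    · exact hleft ⟨hρ.1, h⟩ ⟨by linarith, le_refl r⟩ h
  rw [hGr] at key
  simp only [hGdef] at key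
  linarith

/-- `ρ ↦ R(ρ,Θ | r,Θ)` is monotone on `[r, ∞)`. [cite: FeireislNovotny2009, Ch. 3 Prop. 3.2] -/
theorem monotoneOn_relEnergyThermo_diag (hG : eos.IsGibbs) (hS : eos.IsThermodynamicallyStable)
    {r Θ : ℝ} (hr : 0 < r) (hΘ : 0 < Θ) :
    MonotoneOn (fun σ => eos.relEnergyThermo r Θ σ Θ) (Ici r) := by
  have hmono := strictMonoOn_chemPotential hG hS hΘ
  refine monotoneOn_Ici_of_hasDerivAt_nonneg
    (F' := fun σ => eos.chemPotential σ Θ - eos.chemPotential r Θ * 1) (fun σ hσ => ?_)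
    (fun σ hσ => ?_)
  · unfold relEnergyThermo
    exact ((hG.hasDerivAt_ballisticFreeEnergy_rho (hr.trans_le hσ) hΘ).fun_sub
      (((hasDerivAt_id' σ).sub_const r).const_mul _)).sub_const _
  · have := (hmono.le_iff_le hr (hr.trans hσ)).2 (le_of_lt hσ)
    linarith

/-- `ρ ↦ R(ρ,Θ | r,Θ)` is antitone on `[a, r]` for any `0 < a`.
[cite: FeireislNovotny2009, Ch. 3 Prop. 3.2] -/
theorem antitoneOn_relEnergyThermo_diag (hG : eos.IsGibbs) (hS : eos.IsThermodynamicallyStable)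
    {a r Θ : ℝ} (ha : 0 < a) (hr : 0 < r) (hΘ : 0 < Θ) :
    AntitoneOn (fun σ => eos.relEnergyThermo r Θ σ Θ) (Icc a r) := by
  have hmono := strictMonoOn_chemPotential hG hS hΘ
  refine antitoneOn_Icc_of_hasDerivAt_nonpos
    (F' := fun σ => eos.chemPotential σ Θ - eos.chemPotential r Θ * 1) (fun σ hσ => ?_)
    (fun σ hσ => ?_)
  · unfold relEnergyThermo
    exact ((hG.hasDerivAt_ballisticFreeEnergy_rho (ha.trans_le hσ.1) hΘ).fun_sub
      (((hasDerivAt_id' σ).sub_const r).const_mul _)).sub_const _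
  · have := (hmono.le_iff_le (ha.trans hσ.1) hr).2 (le_of_lt hσ.2)
    linarith

/-- **Linear growth along the isotherm**: for `ρ ≥ r + δ` (`δ ≥ 0`),
`(μ(r+δ,Θ) - μ(r,Θ)) (ρ - r - δ) ≤ R(ρ,Θ | r,Θ)` (a convex function lies above its chords'
continuation; here via monotonicity of `R - κ ρ`). [cite: FeireislNovotny2009, Ch. 3 Prop. 3.2] -/
theorem relEnergyThermo_diag_ge_linear (hG : eos.IsGibbs) (hS : eos.IsThermodynamicallyStable)
    {r Θ δ ρ : ℝ} (hr : 0 < r) (hΘ : 0 < Θ) (hδ : 0 ≤ δ) (hρ : r + δ ≤ ρ) :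
    (eos.chemPotential (r + δ) Θ - eos.chemPotential r Θ) * (ρ - r - δ) ≤
      eos.relEnergyThermo r Θ ρ Θ := by
  set κ := eos.chemPotential (r + δ) Θ - eos.chemPotential r Θ with hκ
  have hmono := strictMonoOn_chemPotential hG hS hΘ
  have hrδ : 0 < r + δ := by linarith
  have hm : MonotoneOn (fun σ => eos.relEnergyThermo r Θ σ Θ - κ * σ) (Ici (r + δ)) := by
    refine monotoneOn_Ici_of_hasDerivAt_nonneg
      (F' := fun σ => eos.chemPotential σ Θ - eos.chemPotential r Θ * 1 - κ * 1)
      (fun σ hσ => ?_) (fun σ hσ => ?_)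
    · unfold relEnergyThermo
      exact (((hG.hasDerivAt_ballisticFreeEnergy_rho (hrδ.trans_le hσ) hΘ).fun_sub
        (((hasDerivAt_id' σ).sub_const r).const_mul _)).sub_const _).fun_sub
        ((hasDerivAt_id' σ).const_mul κ)
    · have : eos.chemPotential (r + δ) Θ ≤ eos.chemPotential σ Θ :=
        (hmono.le_iff_le hrδ (hrδ.trans hσ)).2 (le_of_lt hσ)
      simp only [hκ]
      linarith
  have h1 := hm (self_mem_Ici) hρ hρ
  have h2 : 0 ≤ eos.relEnergyThermo r Θ (r + δ) Θ := relEnergyThermo_diag_nonneg hG hS hr hΘ hrδ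
  simp only at h1
  nlinarith [h1, h2]

/-! ## Along an isochore `ρ = const` -/

/-- **Quadratic lower bound in temperature**: if `∂_ϑ s(ρ,τ) ≥ m ≥ 0` for
`τ ∈ [Θ - δ, Θ + δ] ⊂ (0,∞)`, then `(m ρ/2)(ϑ - Θ)² ≤ H_Θ(ρ,ϑ) - H_Θ(ρ,Θ)` for `|ϑ - Θ| ≤ δ`.
[cite: FeireislNovotny2009, Ch. 3 Prop. 3.2] -/
theorem ballisticFreeEnergy_sub_ge_sq (hG : eos.IsGibbs) {ρ Θ δ m ϑ : ℝ} (hρ : 0 < ρ)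
    (hΘδ : 0 < Θ - δ) (hδ : 0 ≤ δ)
    (hm : ∀ τ ∈ Icc (Θ - δ) (Θ + δ), m ≤ deriv (fun θ => eos.s ρ θ) τ)
    (hϑ : ϑ ∈ Icc (Θ - δ) (Θ + δ)) :
    m * ρ / 2 * (ϑ - Θ) ^ 2 ≤ eos.ballisticFreeEnergy Θ ρ ϑ - eos.ballisticFreeEnergy Θ ρ Θ := by
  set Φ : ℝ → ℝ := fun τ => eos.ballisticFreeEnergy Θ ρ τ - m * ρ / 2 * (τ - Θ) ^ 2 with hΦ
  have hderiv : ∀ τ, 0 < τ → HasDerivAt Φ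
      (ρ * (τ - Θ) * (deriv (fun θ => eos.s ρ θ) τ - m)) τ := by
    intro τ hτ
    have h1 := hG.hasDerivAt_ballisticFreeEnergy_theta Θ hρ hτ
    have h2 : HasDerivAt (fun τ => m * ρ / 2 * (τ - Θ) ^ 2) (m * ρ / 2 * (2 * (τ - Θ) ^ 1 * 1)) τ :=
      (((hasDerivAt_id' τ).sub_const Θ).pow 2).const_mul _
    refine (h1.fun_sub h2).congr_deriv ?_
    ring
  have hright : MonotoneOn Φ (Icc Θ (Θ + δ)) := by
    refine monotoneOn_Icc_of_hasDerivAt_nonneg (fun τ hτ => hderiv τ (by linarith [hτ.1]))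
      (fun τ hτ => ?_)
    have h1 : m ≤ deriv (fun θ => eos.s ρ θ) τ := hm τ ⟨by linarith [hτ.1], hτ.2.le⟩
    have h2 : 0 ≤ τ - Θ := by linarith [hτ.1]
    have h3 : 0 ≤ deriv (fun θ => eos.s ρ θ) τ - m := by linarith
    positivity
  have hleft : AntitoneOn Φ (Icc (Θ - δ) Θ) := by
    refine antitoneOn_Icc_of_hasDerivAt_nonpos (fun τ hτ => hderiv τ (hΘδ.trans_le hτ.1))
      (fun τ hτ => ?_)
    have h1 : m ≤ deriv (fun θ => eos.s ρ θ) τ := hm τ ⟨hτ.1.le, by linarith [hτ.2]⟩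
    have h2 : τ - Θ ≤ 0 := by linarith [hτ.2]
    have h3 : 0 ≤ deriv (fun θ => eos.s ρ θ) τ - m := by linarith
    have : 0 ≤ ρ * (Θ - τ) * (deriv (fun θ => eos.s ρ θ) τ - m) := by
      have h4 : 0 ≤ Θ - τ := by linarith
      positivity
    linarith
  have hΦΘ : Φ Θ = eos.ballisticFreeEnergy Θ ρ Θ := by simp [hΦ]
  have key : Φ Θ ≤ Φ ϑ := by
    rcases le_total Θ ϑ with h | h
    · exact hright ⟨le_refl Θ, by linarith⟩ ⟨h, hϑ.2⟩ h
    · exact hleft ⟨hϑ.1, h⟩ ⟨by linarith, le_refl Θ⟩ h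
  rw [hΦΘ] at key
  simp only [hΦ] at key
  linarith

/-- `e` is non-decreasing in `ϑ` (thermodynamic stability `∂_ϑ e > 0`).
[cite: BrezinaFeireisl2018, (2.19)] -/
theorem e_le_e_of_le (hG : eos.IsGibbs) (hS : eos.IsThermodynamicallyStable) {ρ ϑ ϑ' : ℝ}
    (hρ : 0 < ρ) (hϑ : 0 < ϑ) (h : ϑ ≤ ϑ') : eos.e ρ ϑ ≤ eos.e ρ ϑ' := by
  have hmono : MonotoneOn (fun θ => eos.e ρ θ) (Icc ϑ ϑ') := by
    refine monotoneOn_Icc_of_hasDerivAt_nonneg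
      (fun θ hθ => hG.hasDerivAt_e_theta hρ (hϑ.trans_le hθ.1)) (fun θ hθ => ?_)
    exact le_of_lt (hS ρ θ hρ (hϑ.trans hθ.1)).2
  exact hmono (left_mem_Icc.2 h) (right_mem_Icc.2 h) h

/-- For `ϑ ≥ 2Θ`: `ρ e(ρ,ϑ) - ρ e(ρ,2Θ) ≤ 2 (H_Θ(ρ,ϑ) - H_Θ(ρ,2Θ))` (the internal energy above
`2Θ` is dominated by the ballistic free energy: `d/dτ[2H_Θ - ρe] = ρ ∂_ϑs (τ - 2Θ) ≥ 0`).
[cite: FeireislNovotny2009, Ch. 3 Prop. 3.2] -/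
theorem energy_sub_le_two_mul_ballisticFreeEnergy_sub (hG : eos.IsGibbs)
    (hS : eos.IsThermodynamicallyStable) {ρ Θ ϑ : ℝ} (hρ : 0 < ρ) (hΘ : 0 < Θ) (hϑ : 2 * Θ ≤ ϑ) :
    ρ * eos.e ρ ϑ - ρ * eos.e ρ (2 * Θ) ≤
      2 * (eos.ballisticFreeEnergy Θ ρ ϑ - eos.ballisticFreeEnergy Θ ρ (2 * Θ)) := by
  have h2Θ : 0 < 2 * Θ := by linarith
  have hmono : MonotoneOn (fun τ => 2 * eos.ballisticFreeEnergy Θ ρ τ - ρ * eos.e ρ τ)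
      (Icc (2 * Θ) ϑ) := by
    refine monotoneOn_Icc_of_hasDerivAt_nonneg
      (F' := fun τ => 2 * (ρ * deriv (fun θ => eos.s ρ θ) τ * (τ - Θ)) -
        ρ * deriv (fun θ => eos.e ρ θ) τ) (fun τ hτ => ?_) (fun τ hτ => ?_)
    · have hτ0 : 0 < τ := h2Θ.trans_le hτ.1
      exact ((hG.hasDerivAt_ballisticFreeEnergy_theta Θ hρ hτ0).const_mul 2).fun_sub
        ((hG.hasDerivAt_e_theta hρ hτ0).const_mul ρ)
    · have hτ0 : 0 < τ := h2Θ.trans hτ.1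
      rw [← hG.theta_mul_deriv_s_theta hρ hτ0]
      have hs := deriv_s_theta_pos hG hS hρ hτ0
      have : 2 * (ρ * deriv (fun θ => eos.s ρ θ) τ * (τ - Θ)) -
          ρ * (τ * deriv (fun θ => eos.s ρ θ) τ) =
          ρ * deriv (fun θ => eos.s ρ θ) τ * (τ - 2 * Θ) := by ring
      rw [this]
      have hτ' : 0 ≤ τ - 2 * Θ := by linarith [hτ.1]
      positivity
  have := hmono (left_mem_Icc.2 hϑ) (right_mem_Icc.2 hϑ) hϑ
  simp only at this
  linarith

/-- **Free energy over temperature**: for `0 < ϑ₀ ≤ ϑ₁`,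
`e(ρ,ϑ₀) (1/ϑ₀ - 1/ϑ₁) ≤ f(ρ,ϑ₀)/ϑ₀ - f(ρ,ϑ₁)/ϑ₁` (`d/dϑ (f/ϑ) = -e/ϑ²` and `e` non-decreasing).
[cite: FeireislNovotny2009, §2.2.3] -/
theorem e_mul_inv_sub_inv_le (hG : eos.IsGibbs) (hS : eos.IsThermodynamicallyStable)
    {ρ ϑ₀ ϑ₁ : ℝ} (hρ : 0 < ρ) (hϑ₀ : 0 < ϑ₀) (h : ϑ₀ ≤ ϑ₁) :
    eos.e ρ ϑ₀ * (1 / ϑ₀ - 1 / ϑ₁) ≤ eos.helmholtz ρ ϑ₀ / ϑ₀ - eos.helmholtz ρ ϑ₁ / ϑ₁ := by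
  -- `G(τ) := f(τ)/τ - e₀/τ` is antitone on `[ϑ₀, ∞)`: `G' = (e₀ - e(τ))/τ² ≤ 0`
  have hanti : AntitoneOn (fun τ => eos.helmholtz ρ τ / τ - eos.e ρ ϑ₀ / τ) (Icc ϑ₀ ϑ₁) := by
    refine antitoneOn_Icc_of_hasDerivAt_nonpos
      (F' := fun τ => -(eos.e ρ τ) / τ ^ 2 - (-(eos.e ρ ϑ₀ * 1) / τ ^ 2))
      (fun τ hτ => ?_) (fun τ hτ => ?_)
    · have hτ0 : 0 < τ := hϑ₀.trans_le hτ.1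
      have h1 := hG.hasDerivAt_helmholtz_div_theta hρ hτ0
      have h2 : HasDerivAt (fun τ => eos.e ρ ϑ₀ / τ) ((0 * τ - eos.e ρ ϑ₀ * 1) / τ ^ 2) τ :=
        (hasDerivAt_const τ _).fun_div (hasDerivAt_id' τ) hτ0.ne'
      exact (h1.fun_sub h2).congr_deriv (by ring)
    · have hτ0 : 0 < τ := hϑ₀.trans hτ.1
      have hle : eos.e ρ ϑ₀ ≤ eos.e ρ τ := e_le_e_of_le hG hS hρ hϑ₀ hτ.1.le
      have : -(eos.e ρ τ) / τ ^ 2 - (-(eos.e ρ ϑ₀ * 1) / τ ^ 2) =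
          (eos.e ρ ϑ₀ - eos.e ρ τ) / τ ^ 2 := by ring
      rw [this]
      exact div_nonpos_of_nonpos_of_nonneg (by linarith) (by positivity)
  have key := hanti (left_mem_Icc.2 h) (right_mem_Icc.2 h) h
  simp only at key
  have hϑ₁ : 0 < ϑ₁ := hϑ₀.trans_le h
  have : eos.e ρ ϑ₀ * (1 / ϑ₀ - 1 / ϑ₁) = eos.e ρ ϑ₀ / ϑ₀ - eos.e ρ ϑ₀ / ϑ₁ := by ring
  rw [this]
  linarith

end EulerEOS

end CompressibleEuler

end Literature.Analysis.FluidPDE
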